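import Mathlib.MeasureTheory.Integral.Prod
import Mathlib.MeasureTheory.Integral.IntegralEqImproper
import Literature.Analysis.FluidPDE.SuitableWeak
import Literature.Analysis.FluidPDE.SpaceTimeCalculusC1
import Literature.Analysis.FluidPDE.LerayHopfProofs
import HarnessLib

/-!
# `C²` classical solutions of Navier–Stokes are suitable weak solutions

Analysis/FluidPDE proofs-layer file (theorems only, no new definitions) over the accepted
structures `IsSuitableWeakSolutionOn`, `HasWeakSpatialGradientOn` (`SuitableWeak.lean`;
Caffarelli–Kohn–Nirenberg 1982, §2, (2.1)–(2.5); Lin 1998, Def. 1) and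
`IsDistributionalNSSolutionOn` (`WeakSolution.lean`). It serves the decomposition of the named
fact `Literature.Analysis.FluidPDE.tsai1998_lemma41` (`TsaiLocalEnergy`; Tsai 1998, Lemma 4.1:
the self-similar field `u = λ(t)U(λ(t)x)` of a `C²` profile is a classical solution on
`{t < T} × ℝ³` which blows up at `t = T`, and Lemma 4.1 asserts that with the right pressure it
is a *suitable weak solution* on the parabolic cylinder `Q₁(0, T)`), but is stated in general.

## Main statement

Let `E` be a finite-dimensional real inner product space, `S ⊆ ℝ` an **open** set of times and
`Q ⊆ S × E` an open space–time region. Let `u : ℝ → E → E` be jointly `C²` and `p : ℝ → E → ℝ`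
jointly `C¹` on `S × E` (`ContDiffOn ℝ 2 (uncurry u) (S ×ˢ univ)`, …), `f` jointly continuous
there, and assume the Navier–Stokes system pointwise on `S × E`:
`∂ₜu + (u·∇)u = νΔu − ∇p + f` (with the honest two-sided time derivative `timeDeriv`, `S` being
open) and `div u = 0`. Then (`isSuitableWeakSolutionOn_of_contDiffOn`) `(u, p)` is a suitable
weak solution on `Q` with viscosity `ν` and force `f`; more precisely

* `isDistributionalNSSolutionOn_of_contDiffOn`: the equations hold in `𝒟'(Q)` (CKN (2.2));
* `hasWeakSpatialGradientOn_of_contDiffOn`: the classical slice derivative `Dₓu` is a weak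
  spatial gradient of `u` on `Q` (already for `u` jointly `C¹`);
* `local_energy_eq_of_contDiffOn`: the local energy inequality (2.5) holds **with equality**,
  `2ν ∫∫ |∇u|² φ = ∫∫ (|u|² (∂ₜφ + νΔφ) + (|u|² + 2p) u·∇φ + 2 ⟪f, u⟫ φ)` for every test
  function `φ` on `Q` ("if `u` is smooth, (2.5) holds with equality", CKN 1982, §2);
* the local classes `u ∈ L^∞_t L²_x`, `∇u ∈ L²`, `p ∈ L^{3/2}` on compact subsets of `Q` are
  immediate from continuity.

Nothing is assumed about `(u, p)` off `S × E`; in particular blow-up at a boundary time of `S`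
(as for Leray's backward self-similar fields at `t = T`) is allowed, since test functions on
`Q` are supported at positive distance from it. Only `C²`/`C¹` regularity is used (not the
`C^∞` class `IsClassicalNSSolutionOn` of `ClassicalSolution.lean`), which is what the pointwise
profile class `IsLerayProfile` (`U ∈ C²`, `P ∈ C¹`) provides.

## Proof

As in print (CKN 1982, §2; Leray 1934, §III for the weak formulation): at a fixed time, pair
the momentum equation with a compactly supported field and integrate by parts in `x` with the
boundary-free identities of `WholeSpaceIBP` — this gives the slice identities
`integral_inner_dt_test_of_momentum` (`∫ ⟪∂ₜu, ψ⟫ = ∫ (⟪u,(u·∇)ψ⟫ + ν⟪u,Δψ⟫ + p div ψ + ⟪f,ψ⟫)`)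
and `integral_mul_inner_dt_of_momentum` / `integral_energy_flux_eq_of_momentum` (the local
energy balance against `φ u`, using `Σᵢ ∫ ∂ᵢφ ⟪∂ᵢu, u⟫ = −½ ∫ Δφ |u|²`); then integrate in time:
on each time line `s ↦ ⟪u, ψ⟫(s, x)` resp. `s ↦ φ|u|²(s, x)` is `C¹` with compact support, so
its derivative integrates to zero (`integral_integral_eq_zero_of_hasDerivAt_time`, via Mathlib's
`integral_eq_zero_of_hasDerivAt_of_integrable` and Fubini), which is the step
`∫∫ ⟪u, ∂ₜψ⟫ = −∫∫ ⟪∂ₜu, ψ⟫`. All space–time integrands are continuous on `S × E` and vanish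
off the compact support of the test function, hence are continuous with compact support on
`ℝ × E` (`continuous_of_continuousOn_of_eq_zero`), so Fubini applies and the integral over `Q`
is the iterated integral (`setIntegral_eq_integral_integral_of_continuousOn`).

## Mathlib / tree search

Mathlib (this pin): `integral_eq_zero_of_hasDerivAt_of_integrable`, `integral_prod`,
`integral_integral_swap`, `HasDerivAt.inner`, `HasDerivAt.norm_sq`, `HasFDerivAt.norm_sq`,
`ContDiffOn.continuousOn_fderiv_of_isOpen`, `hasFDerivAt_prodMk_left/right`,
`ContinuousOn.locallyIntegrableOn`, `Continuous.integrable_of_hasCompactSupport` (all used).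
Tree: the whole-space integrations by parts `integral_inner_convect_add_eq_zero`,
`integral_inner_laplacian_add_eq_zero`, `integral_inner_gradient_eq_neg_integral_mul_divergence`,
`integral_fderiv_apply_eq_zero` (`WholeSpaceIBP`), `integral_inner_laplacian_comm` and the test
field calculus `IsSpaceTimeTestOn.*` (`ClassicalSolutionCalculus`),
`IsDivFree.isWeaklyDivFree_holds` (`VectorCalculus`). Related but not usable here:
`IsClassicalNSSolutionOn.isWeakNSSolutionOn_holds` (`ClassicalSolutionCalculus`, jointly `C^∞`
solutions on `[0, T]`, pressure-free weak form) and `local_energy_identity_smooth`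
(`SmoothLocalEnergy`, jointly `C^∞` fields on all of `ℝ × E`, mollified system).

## References

* L. Caffarelli, R. Kohn, L. Nirenberg, *Partial regularity of suitable weak solutions of the
  Navier–Stokes equations*, Comm. Pure Appl. Math. 35 (1982) 771–831, §2, (2.1)–(2.5) and the
  remark "if `u` is smooth, (2.5) holds with equality" [CaffarelliKohnNirenberg1982].
* F. Lin, *A new proof of the Caffarelli–Kohn–Nirenberg theorem*, Comm. Pure Appl. Math. 51
  (1998), Def. 1 [Lin1998].
* T.-P. Tsai, *On Leray's self-similar solutions of the Navier–Stokes equations satisfying local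
  energy estimates*, Arch. Rational Mech. Anal. 143 (1998), p. 33 ("(iv) is satisfied by any
  smooth solution of (1.1)") and Lemma 4.1 (p. 46) [Tsai1998].
* J. Leray, *Sur le mouvement d'un liquide visqueux emplissant l'espace*, Acta Math. 63 (1934),
  §III, (17) [Leray1934].
-/

noncomputable section

open MeasureTheory TopologicalSpace Set Function Filter Topology Metric
open scoped Laplacian InnerProductSpace RealInnerProductSpace ENNReal NNReal ContDiff

namespace Literature.Analysis.FluidPDE

variable {E : Type*} [NormedAddCommGroup E] [InnerProductSpace ℝ E] [FiniteDimensional ℝ E]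
  [MeasurableSpace E] [BorelSpace E]

/-! ### Slice identities: integration by parts in space at a fixed time -/

section Slice

variable {ν : ℝ} {u dtu f : E → E} {p : E → ℝ}

/-- **The momentum equation against a test field, at a fixed time.** Let `u ∈ C²(E; E)` be
divergence free, `p ∈ C¹`, `dtu`, `f` continuous with `dtu + (u·∇)u = νΔu − ∇p + f` pointwise
(so `dtu` plays the rôle of `∂ₜu`). Then for every `ψ ∈ C²_c(E; E)`
`∫ ⟪dtu, ψ⟫ = ∫ (⟪u, (u·∇)ψ⟫ + ν ⟪u, Δψ⟫ + p div ψ + ⟪f, ψ⟫)`: the nonlinear, viscous and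
pressure terms are moved onto `ψ` by the whole-space integrations by parts of `WholeSpaceIBP`
(Caffarelli–Kohn–Nirenberg 1982, §2, (2.2): "(1.1) holds in the sense of distributions" for
smooth solutions; Leray 1934, §III, derivation of (17)). [cite: CaffarelliKohnNirenberg1982, §2 (2.2)] -/
theorem integral_inner_dt_test_of_momentum (hu : ContDiff ℝ 2 u) (hp : ContDiff ℝ 1 p)
    (hdt : Continuous dtu) (hf : Continuous f)
    (hmom : ∀ x, dtu x + convect u u x = ν • (Δ u) x - gradient p x + f x)
    (hdiv : VectorCalculus.IsDivFree u) {ψ : E → E} (hψ : ContDiff ℝ 2 ψ)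
    (hc : HasCompactSupport ψ) :
    ∫ x, ⟪dtu x, ψ x⟫ =
      ∫ x, (⟪u x, convect u ψ x⟫ + ν * ⟪u x, (Δ ψ) x⟫ +
        p x * VectorCalculus.divergence ψ x + ⟪f x, ψ x⟫) := by
  have hu1 : ContDiff ℝ 1 u := hu.of_le one_le_two
  have hψ1 : ContDiff ℝ 1 ψ := hψ.of_le one_le_two
  have huc : Continuous u := hu1.continuous
  have hψc : Continuous ψ := hψ1.continuous
  -- the force through the equation
  have hf_eq : ∀ x, f x = dtu x + convect u u x - ν • (Δ u) x + gradient p x := fun x => by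
    have := hmom x
    rw [eq_comm, ← sub_eq_zero] at this
    rw [← sub_eq_zero, ← this]
    abel
  -- integrability of every pairing with `ψ`
  have iT := integrable_inner_of_hasCompactSupport_right hdt hψc hc
  have iC : Integrable (fun x => ⟪convect u u x, ψ x⟫) (volume : Measure E) :=
    integrable_inner_of_hasCompactSupport_right
      ((hu1.continuous_fderiv one_ne_zero).clm_apply huc) hψc hc
  have iL := integrable_inner_of_hasCompactSupport_right (continuous_laplacian hu) hψc hc
  have iP := integrable_inner_of_hasCompactSupport_right (continuous_gradient_of_contDiff hp)
    hψc hc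
  have iF := integrable_inner_of_hasCompactSupport_right hf hψc hc
  have iC' : Integrable (fun x => ⟪u x, convect u ψ x⟫) (volume : Measure E) :=
    integrable_inner_of_hasCompactSupport_right huc
      ((hψ1.continuous_fderiv one_ne_zero).clm_apply huc)
      ((hc.fderiv (𝕜 := ℝ)).mono fun x hx => by
        contrapose! hx; simp only [mem_support, not_not] at hx; simp [convect, hx])
  have iL' : Integrable (fun x => ⟪u x, (Δ ψ) x⟫) (volume : Measure E) :=
    integrable_inner_of_hasCompactSupport_right huc (continuous_laplacian hψ)
      (hc.mono' fun x hx => by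
        contrapose! hx; simp [laplacian_eq_zero_of_notMem_tsupport hx])
  have iD : Integrable (fun x => p x * VectorCalculus.divergence ψ x) (volume : Measure E) := by
    refine (hp.continuous.mul (continuous_divergence (hψ1.continuous_fderiv one_ne_zero)))
      |>.integrable_of_hasCompactSupport ?_
    refine hc.mono' fun x hx => ?_
    contrapose! hx
    simp [divergence_eq_zero_of_notMem_tsupport hx]
  -- integration by parts, term by term
  have eC : ∫ x, ⟪convect u u x, ψ x⟫ = -∫ x, ⟪u x, convect u ψ x⟫ := by
    have h0 := integral_inner_convect_add_eq_zero hu1 hu1 hψ1 hc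
    have hz : ∫ x, VectorCalculus.divergence u x * ⟪u x, ψ x⟫ = 0 := by simp [hdiv _]
    linarith
  have eL : ∫ x, ⟪(Δ u) x, ψ x⟫ = ∫ x, ⟪u x, (Δ ψ) x⟫ := integral_inner_laplacian_comm hu hψ hc
  have eP : ∫ x, ⟪gradient p x, ψ x⟫ = -∫ x, p x * VectorCalculus.divergence ψ x :=
    integral_inner_gradient_eq_neg_integral_mul_divergence hp hψ1 hc
  -- assemble
  have key : ∀ x, ⟪dtu x, ψ x⟫ = ⟪f x, ψ x⟫ -
      ⟪convect u u x, ψ x⟫ + ν * ⟪(Δ u) x, ψ x⟫ - ⟪gradient p x, ψ x⟫ := by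
    intro x
    rw [hf_eq x]
    simp only [inner_add_left, inner_sub_left, inner_smul_left, RCLike.conj_to_real]
    ring
  have j1 : Integrable (fun x => ⟪f x, ψ x⟫ - ⟪convect u u x, ψ x⟫) (volume : Measure E) :=
    iF.sub iC
  have j2 : Integrable (fun x => ν * ⟪(Δ u) x, ψ x⟫) (volume : Measure E) := iL.const_mul ν
  have j3 : Integrable (fun x => ⟪f x, ψ x⟫ - ⟪convect u u x, ψ x⟫ + ν * ⟪(Δ u) x, ψ x⟫)
      (volume : Measure E) := j1.add j2
  have j4 : Integrable (fun x => ν * ⟪u x, (Δ ψ) x⟫) (volume : Measure E) := iL'.const_mul ν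
  have j5 : Integrable (fun x => ⟪u x, convect u ψ x⟫ + ν * ⟪u x, (Δ ψ) x⟫)
      (volume : Measure E) := iC'.add j4
  have j6 : Integrable (fun x => ⟪u x, convect u ψ x⟫ + ν * ⟪u x, (Δ ψ) x⟫ +
      p x * VectorCalculus.divergence ψ x) (volume : Measure E) := j5.add iD
  rw [integral_congr_ae (Eventually.of_forall key), integral_sub j3 iP, integral_add j1 j2,
    integral_sub iF iC, integral_const_mul, integral_add j6 iF, integral_add j5 iD,
    integral_add iC' j4, integral_const_mul, eC, eL, eP]
  ring

/-- `Σᵢ ∫ ∂ᵢφ ⟪∂ᵢu, u⟫ = −½ ∫ Δφ |u|²` for `φ ∈ C²_c`, `u ∈ C¹` (Green's first identity without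
boundary for the scalar functions `φ` and `|u|²`, `∂ᵢ|u|² = 2⟪∂ᵢu, u⟫`; Caffarelli–Kohn–Nirenberg
1982, §2, the passage from `2ν ∫ (u·Δu) φ` to `ν ∫ |u|² Δφ` in (2.5)). [cite: CaffarelliKohnNirenberg1982, §2 (2.5)] -/
theorem sum_integral_fderiv_mul_inner_fderiv_eq {φ : E → ℝ} (hφ : ContDiff ℝ 2 φ)
    (hc : HasCompactSupport φ) (hu : ContDiff ℝ 1 u) :
    ∑ i, ∫ x, fderiv ℝ φ x (stdOrthonormalBasis ℝ E i) *
        ⟪fderiv ℝ u x (stdOrthonormalBasis ℝ E i), u x⟫ =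
      -(2⁻¹ * ∫ x, (Δ φ) x * ‖u x‖ ^ 2) := by
  set b := stdOrthonormalBasis ℝ E
  have hN : ContDiff ℝ 1 fun x => ‖u x‖ ^ 2 := hu.norm_sq ℝ
  have h0 := integral_inner_laplacian_add_eq_zero (F' := ℝ) b hφ hN (Or.inl hc)
  have hD : ∀ x i, fderiv ℝ (fun x => ‖u x‖ ^ 2) x (b i) = 2 * ⟪fderiv ℝ u x (b i), u x⟫ := by
    intro x i
    rw [((hu.differentiable one_ne_zero x).hasFDerivAt.norm_sq).fderiv]
    simp only [FunLike.coe_smul, Pi.smul_apply, ContinuousLinearMap.comp_apply,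
      innerSL_apply_apply, nsmul_eq_mul, Nat.cast_ofNat]
    rw [real_inner_comm]
  have h1 : ∀ i, ∫ x, ⟪fderiv ℝ φ x (b i), fderiv ℝ (fun x => ‖u x‖ ^ 2) x (b i)⟫ =
      2 * ∫ x, fderiv ℝ φ x (b i) * ⟪fderiv ℝ u x (b i), u x⟫ := by
    intro i
    rw [← integral_const_mul]
    refine integral_congr_ae (Eventually.of_forall fun x => ?_)
    simp only [hD, RCLike.inner_apply, conj_trivial]
    ring
  have h2 : ∫ x, ⟪(Δ φ) x, ‖u x‖ ^ 2⟫ = ∫ x, (Δ φ) x * ‖u x‖ ^ 2 :=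
    integral_congr_ae (Eventually.of_forall fun x => by
      simp only [RCLike.inner_apply, conj_trivial, mul_comm])
  simp_rw [h1] at h0
  rw [h2, ← Finset.mul_sum] at h0
  linarith

/-- **The local energy balance at a fixed time.** Let `u ∈ C²(E; E)` be divergence free,
`p ∈ C¹`, `dtu`, `f` continuous with `dtu + (u·∇)u = νΔu − ∇p + f` pointwise. Then for every
scalar `φ ∈ C²_c(E)`, pairing the equation with `φ u` and integrating by parts in `x`,
`∫ φ ⟪dtu, u⟫ = ½ ∫ (Dφ·u)|u|² − ν ∫ φ |∇u|² + (ν/2) ∫ Δφ |u|² + ∫ p (Dφ·u) + ∫ φ ⟪f, u⟫`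
(`|∇u|²` the Frobenius norm `frobeniusNormSq (Du)`): the slice form of the local energy
*equality* of smooth solutions (Caffarelli–Kohn–Nirenberg 1982, §2, (2.5) with equality: "if
`u` is smooth, (2.5) holds with equality"; Leray 1934, §17, (3.4)). [cite: CaffarelliKohnNirenberg1982, §2 (2.5)] -/
theorem integral_mul_inner_dt_of_momentum (hu : ContDiff ℝ 2 u) (hp : ContDiff ℝ 1 p)
    (hdt : Continuous dtu) (hf : Continuous f)
    (hmom : ∀ x, dtu x + convect u u x = ν • (Δ u) x - gradient p x + f x)
    (hdiv : VectorCalculus.IsDivFree u) {φ : E → ℝ} (hφ : ContDiff ℝ 2 φ)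
    (hc : HasCompactSupport φ) :
    ∫ x, φ x * ⟪dtu x, u x⟫ =
      2⁻¹ * (∫ x, fderiv ℝ φ x (u x) * ‖u x‖ ^ 2)
      - ν * (∫ x, φ x * frobeniusNormSq (fderiv ℝ u x))
      + 2⁻¹ * ν * (∫ x, (Δ φ) x * ‖u x‖ ^ 2)
      + (∫ x, p x * fderiv ℝ φ x (u x))
      + ∫ x, φ x * ⟪f x, u x⟫ := by
  set b := stdOrthonormalBasis ℝ E
  have hφ1 : ContDiff ℝ 1 φ := hφ.of_le one_le_two
  set w : E → E := fun x => φ x • u x with hw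
  -- regularity
  have hu1 : ContDiff ℝ 1 u := hu.of_le one_le_two
  have hw1 : ContDiff ℝ 1 w := hφ1.smul hu1
  have hcw : HasCompactSupport w := hc.smul_right
  have huc : Continuous u := hu1.continuous
  have hφc : Continuous φ := hφ1.continuous
  have hDφc : Continuous (fderiv ℝ φ) := hφ1.continuous_fderiv one_ne_zero
  have hDuc : Continuous (fderiv ℝ u) := hu1.continuous_fderiv one_ne_zero
  have hwc : Continuous w := hw1.continuous
  have hcDφ : HasCompactSupport (fderiv ℝ φ) := hc.fderiv (𝕜 := ℝ)
  -- the force through the equation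
  have hf_eq : ∀ x, f x = dtu x + convect u u x - ν • (Δ u) x + gradient p x := fun x => by
    have := hmom x
    rw [eq_comm, ← sub_eq_zero] at this
    rw [← sub_eq_zero, ← this]
    abel
  -- pointwise Leibniz rules for `w = φ u`
  have hDw : ∀ x v, fderiv ℝ w x v = φ x • fderiv ℝ u x v + (fderiv ℝ φ x v) • u x :=
    fun x v => by
      simp [hw, fderiv_fun_smul (hφ1.differentiable one_ne_zero x) (hu1.differentiable one_ne_zero x)]
  have hCw : ∀ x, convect u w x = φ x • convect u u x + (fderiv ℝ φ x (u x)) • u x :=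
    fun x => convect_smul_apply (hφ1.differentiable one_ne_zero x) (hu1.differentiable one_ne_zero x)
  -- integrability of every term (continuous with compact support)
  have cs_φ : ∀ {g : E → ℝ}, Continuous g → Integrable (fun x => φ x * g x) (volume : Measure E) :=
    fun hg => (hφc.mul hg).integrable_of_hasCompactSupport hc.mul_right
  have cs_Dφ : ∀ {g : E → ℝ} (v : E → E), Continuous g → Continuous v →
      Integrable (fun x => fderiv ℝ φ x (v x) * g x) (volume : Measure E) := fun v hg hv =>
    ((hDφc.clm_apply hv).mul hg).integrable_of_hasCompactSupport
      ((hcDφ.mono fun x hx => by contrapose! hx; simp_all).mul_right)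
  -- (i) the convection term
  have eC : ∫ x, ⟪convect u u x, w x⟫ = -(2⁻¹ * ∫ x, fderiv ℝ φ x (u x) * ‖u x‖ ^ 2) := by
    have h0 := integral_inner_convect_add_eq_zero hu1 hu1 hw1 hcw
    have hz : ∫ x, VectorCalculus.divergence u x * ⟪u x, w x⟫ = 0 := by simp [hdiv _]
    have hA : ∫ x, ⟪convect u u x, w x⟫ = ∫ x, φ x * ⟪u x, convect u u x⟫ :=
      integral_congr_ae (Eventually.of_forall fun x => by
        simp only [hw, real_inner_smul_right]
        rw [real_inner_comm])
    have iA : Integrable (fun x => φ x * ⟪u x, convect u u x⟫) (volume : Measure E) :=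
      cs_φ (huc.inner (hDuc.clm_apply huc))
    have iB : Integrable (fun x => fderiv ℝ φ x (u x) * ‖u x‖ ^ 2) (volume : Measure E) :=
      cs_Dφ _ (huc.norm.pow 2) huc
    have hB : ∫ x, ⟪u x, convect u w x⟫ = (∫ x, φ x * ⟪u x, convect u u x⟫) +
        ∫ x, fderiv ℝ φ x (u x) * ‖u x‖ ^ 2 := by
      rw [← integral_add iA iB]
      refine integral_congr_ae (Eventually.of_forall fun x => ?_)
      simp only [hCw, inner_add_right, real_inner_smul_right, real_inner_self_eq_norm_sq]
    rw [hA] at h0 ⊢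
    linarith
  -- (ii) the viscous term
  have eL : ∫ x, ⟪(Δ u) x, w x⟫ = -(∫ x, φ x * frobeniusNormSq (fderiv ℝ u x)) +
      2⁻¹ * ∫ x, (Δ φ) x * ‖u x‖ ^ 2 := by
    have h0 := integral_inner_laplacian_add_eq_zero b hu hw1 (Or.inr hcw)
    have iA : ∀ i, Integrable (fun x => φ x * ‖fderiv ℝ u x (b i)‖ ^ 2) (volume : Measure E) :=
      fun i => cs_φ ((hDuc.clm_apply continuous_const).norm.pow 2)
    have iB : ∀ i, Integrable (fun x => fderiv ℝ φ x (b i) * ⟪fderiv ℝ u x (b i), u x⟫)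
        (volume : Measure E) := fun i =>
      cs_Dφ _ ((hDuc.clm_apply continuous_const).inner huc) continuous_const
    have h1 : ∀ i, ∫ x, ⟪fderiv ℝ u x (b i), fderiv ℝ w x (b i)⟫ =
        (∫ x, φ x * ‖fderiv ℝ u x (b i)‖ ^ 2) +
          ∫ x, fderiv ℝ φ x (b i) * ⟪fderiv ℝ u x (b i), u x⟫ := fun i => by
      rw [← integral_add (iA i) (iB i)]
      refine integral_congr_ae (Eventually.of_forall fun x => ?_)
      simp only [hDw, inner_add_right, real_inner_smul_right, real_inner_self_eq_norm_sq]
    have h2 : ∑ i, ∫ x, φ x * ‖fderiv ℝ u x (b i)‖ ^ 2 =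
        ∫ x, φ x * frobeniusNormSq (fderiv ℝ u x) := by
      rw [← integral_finsetSum _ fun i _ => iA i]
      refine integral_congr_ae (Eventually.of_forall fun x => ?_)
      simp only [frobeniusNormSq_eq_sum b, Finset.mul_sum]
    have h3 := sum_integral_fderiv_mul_inner_fderiv_eq hφ hc hu1
    simp_rw [h1] at h0
    rw [Finset.sum_add_distrib, h2, h3] at h0
    linarith
  -- (iii) the pressure term
  have eP : ∫ x, ⟪gradient p x, w x⟫ = -∫ x, p x * fderiv ℝ φ x (u x) := by
    rw [integral_inner_gradient_eq_neg_integral_mul_divergence hp hw1 hcw]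
    congr 1
    refine integral_congr_ae (Eventually.of_forall fun x => ?_)
    simp only [hw]
    rw [divergence_smul_apply (hφ1.differentiable one_ne_zero x) (hu1.differentiable one_ne_zero x),
      hdiv x, mul_zero, zero_add, gradient, real_inner_comm, InnerProductSpace.toDual_symm_apply]
  -- integrability of the paired terms
  have iT : Integrable (fun x => ⟪dtu x, w x⟫) (volume : Measure E) :=
    integrable_inner_of_hasCompactSupport_right hdt hwc hcw
  have iC : Integrable (fun x => ⟪convect u u x, w x⟫) (volume : Measure E) :=
    integrable_inner_of_hasCompactSupport_right (hDuc.clm_apply huc) hwc hcw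
  have iL : Integrable (fun x => ⟪(Δ u) x, w x⟫) (volume : Measure E) :=
    integrable_inner_of_hasCompactSupport_right (continuous_laplacian hu) hwc hcw
  have iP : Integrable (fun x => ⟪gradient p x, w x⟫) (volume : Measure E) :=
    integrable_inner_of_hasCompactSupport_right (continuous_gradient_of_contDiff hp) hwc hcw
  have iF : Integrable (fun x => ⟪f x, w x⟫) (volume : Measure E) :=
    integrable_inner_of_hasCompactSupport_right hf hwc hcw
  -- assemble
  have hL : ∫ x, φ x * ⟪dtu x, u x⟫ = ∫ x, ⟪dtu x, w x⟫ :=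
    integral_congr_ae (Eventually.of_forall fun x => by simp only [hw, real_inner_smul_right])
  have hF : ∫ x, φ x * ⟪f x, u x⟫ = ∫ x, ⟪f x, w x⟫ :=
    integral_congr_ae (Eventually.of_forall fun x => by simp only [hw, real_inner_smul_right])
  have key : ∀ x, ⟪dtu x, w x⟫ = ⟪f x, w x⟫ -
      ⟪convect u u x, w x⟫ + ν * ⟪(Δ u) x, w x⟫ - ⟪gradient p x, w x⟫ := by
    intro x
    rw [hf_eq x]
    simp only [inner_add_left, inner_sub_left, inner_smul_left, RCLike.conj_to_real]
    ring
  have j1 : Integrable (fun x => ⟪f x, w x⟫ - ⟪convect u u x, w x⟫) (volume : Measure E) :=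
    iF.sub iC
  have j2 : Integrable (fun x => ν * ⟪(Δ u) x, w x⟫) (volume : Measure E) := iL.const_mul ν
  have j3 : Integrable (fun x => ⟪f x, w x⟫ - ⟪convect u u x, w x⟫ + ν * ⟪(Δ u) x, w x⟫)
      (volume : Measure E) := j1.add j2
  rw [hL, hF, integral_congr_ae (Eventually.of_forall key), integral_sub j3 iP, integral_add j1 j2,
    integral_sub iF iC, integral_const_mul, eC, eL, eP]
  ring

/-- The local energy balance at a fixed time, rearranged as it enters the space–time identity:
`∫ (ν Δφ |u|² + (Dφ·u)|u|² + 2 p (Dφ·u) + 2 φ ⟪f, u⟫) = ∫ 2 φ ⟪u, dtu⟫ + 2ν ∫ |∇u|² φ`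
(Caffarelli–Kohn–Nirenberg 1982, §2, (2.5) with equality for smooth solutions). [cite: CaffarelliKohnNirenberg1982, §2 (2.5)] -/
theorem integral_energy_flux_eq_of_momentum (hu : ContDiff ℝ 2 u) (hp : ContDiff ℝ 1 p)
    (hdt : Continuous dtu) (hf : Continuous f)
    (hmom : ∀ x, dtu x + convect u u x = ν • (Δ u) x - gradient p x + f x)
    (hdiv : VectorCalculus.IsDivFree u) {φ : E → ℝ} (hφ : ContDiff ℝ 2 φ)
    (hc : HasCompactSupport φ) :
    ∫ x, (ν * ((Δ φ) x * ‖u x‖ ^ 2) + fderiv ℝ φ x (u x) * ‖u x‖ ^ 2 +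
        2 * (p x * fderiv ℝ φ x (u x)) + 2 * (φ x * ⟪f x, u x⟫)) =
      (∫ x, φ x * (2 * ⟪u x, dtu x⟫)) + 2 * ν * ∫ x, frobeniusNormSq (fderiv ℝ u x) * φ x := by
  have h0 := integral_mul_inner_dt_of_momentum hu hp hdt hf hmom hdiv hφ hc
  have hu1 : ContDiff ℝ 1 u := hu.of_le one_le_two
  have hφ1 : ContDiff ℝ 1 φ := hφ.of_le one_le_two
  have huc : Continuous u := hu1.continuous
  have hφc : Continuous φ := hφ1.continuous
  have hDφc : Continuous (fderiv ℝ φ) := hφ1.continuous_fderiv one_ne_zero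
  have hDuc : Continuous (fderiv ℝ u) := hu1.continuous_fderiv one_ne_zero
  have hcDφ : HasCompactSupport (fderiv ℝ φ) := hc.fderiv (𝕜 := ℝ)
  have cs_φ : ∀ {g : E → ℝ}, Continuous g → Integrable (fun x => φ x * g x) (volume : Measure E) :=
    fun hg => (hφc.mul hg).integrable_of_hasCompactSupport hc.mul_right
  have cs_Dφ : ∀ {g : E → ℝ} (v : E → E), Continuous g → Continuous v →
      Integrable (fun x => fderiv ℝ φ x (v x) * g x) (volume : Measure E) := fun v hg hv =>
    ((hDφc.clm_apply hv).mul hg).integrable_of_hasCompactSupport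
      ((hcDφ.mono fun x hx => by contrapose! hx; simp_all).mul_right)
  have i1 : Integrable (fun x => ν * ((Δ φ) x * ‖u x‖ ^ 2)) (volume : Measure E) := by
    refine (((continuous_laplacian hφ).mul (huc.norm.pow 2)).integrable_of_hasCompactSupport
      ?_).const_mul ν
    exact (hc.mono' fun x hx => by
      contrapose! hx; simp [laplacian_eq_zero_of_notMem_tsupport hx]).mul_right
  have i2 : Integrable (fun x => fderiv ℝ φ x (u x) * ‖u x‖ ^ 2) (volume : Measure E) :=
    cs_Dφ _ (huc.norm.pow 2) huc
  have i3 : Integrable (fun x => 2 * (p x * fderiv ℝ φ x (u x))) (volume : Measure E) := by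
    have := cs_Dφ _ hp.continuous huc
    refine (this.congr (Eventually.of_forall fun x => ?_)).const_mul 2
    simp only [mul_comm]
  have i4 : Integrable (fun x => 2 * (φ x * ⟪f x, u x⟫)) (volume : Measure E) :=
    (cs_φ (hf.inner huc)).const_mul 2
  have e1 : ∫ x, φ x * (2 * ⟪u x, dtu x⟫) = 2 * ∫ x, φ x * ⟪dtu x, u x⟫ := by
    rw [← integral_const_mul]
    refine integral_congr_ae (Eventually.of_forall fun x => ?_)
    show φ x * (2 * ⟪u x, dtu x⟫) = 2 * (φ x * ⟪dtu x, u x⟫)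
    rw [real_inner_comm]
    ring
  have e2 : ∫ x, frobeniusNormSq (fderiv ℝ u x) * φ x = ∫ x, φ x * frobeniusNormSq (fderiv ℝ u x) :=
    integral_congr_ae (Eventually.of_forall fun x => mul_comm _ _)
  have i12 : Integrable (fun x => ν * ((Δ φ) x * ‖u x‖ ^ 2) + fderiv ℝ φ x (u x) * ‖u x‖ ^ 2)
      (volume : Measure E) := i1.add i2
  have i123 : Integrable (fun x => ν * ((Δ φ) x * ‖u x‖ ^ 2) + fderiv ℝ φ x (u x) * ‖u x‖ ^ 2 +
      2 * (p x * fderiv ℝ φ x (u x))) (volume : Measure E) := i12.add i3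
  rw [integral_add i123 i4, integral_add i12 i3, integral_add i1 i2,
    integral_const_mul, integral_const_mul, integral_const_mul, e1, e2, h0]
  ring

end Slice

/-! ### Space–time tools: supports of test functions, joint regularity, pairing in time -/

section SpaceTime

variable {F : Type*} [NormedAddCommGroup F] [NormedSpace ℝ F]

omit [InnerProductSpace ℝ E] [FiniteDimensional ℝ E] [MeasurableSpace E] [BorelSpace E] in
/-- Off the topological support of (the uncurried) `ψ`, the time derivative `∂ₜψ` vanishes
(`ψ(·, x)` vanishes near `t`). [folklore] -/
theorem timeDeriv_eq_zero_off_tsupport [NormedSpace ℝ E] {ψ : ℝ → E → F} {t : ℝ} {x : E}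
    (h : (t, x) ∉ tsupport (uncurry ψ)) : timeDeriv ψ t x = 0 := by
  have h1 : uncurry ψ =ᶠ[𝓝 (t, x)] 0 := notMem_tsupport_iff_eventuallyEq.1 h
  have h2 : (fun s => ψ s x) =ᶠ[𝓝 t] fun _ => (0 : F) :=
    ((Continuous.prodMk_left x).continuousAt.eventually h1).mono fun s hs => hs
  rw [timeDeriv_apply, h2.deriv_eq, deriv_const]

omit [InnerProductSpace ℝ E] [FiniteDimensional ℝ E] [MeasurableSpace E] [BorelSpace E] in
/-- A function vanishing near a point has time derivative zero there and its time line has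
derivative zero. [folklore] -/
theorem hasDerivAt_zero_of_notMem_tsupport [NormedSpace ℝ E] {a : ℝ → E → F} {t : ℝ} {x : E}
    (h : (t, x) ∉ tsupport (uncurry a)) : HasDerivAt (fun s => a s x) 0 t := by
  have h1 : uncurry a =ᶠ[𝓝 (t, x)] 0 := notMem_tsupport_iff_eventuallyEq.1 h
  have h2 : (fun s => a s x) =ᶠ[𝓝 t] fun _ => (0 : F) :=
    ((Continuous.prodMk_left x).continuousAt.eventually h1).mono fun s hs => hs
  exact (hasDerivAt_const t (0 : F)).congr_of_eventuallyEq h2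

omit [NormedSpace ℝ F] in
/-- **Gluing continuity**: a function continuous on an open set `O` and vanishing off a closed
set `K ⊆ O` is continuous everywhere. [folklore] -/
theorem continuous_of_continuousOn_of_eq_zero {X : Type*}
    [TopologicalSpace X] {G : X → F} {O K : Set X} (hO : IsOpen O) (hK : IsClosed K)
    (hKO : K ⊆ O) (hG : ContinuousOn G O) (h0 : ∀ z ∉ K, G z = 0) : Continuous G := by
  refine continuous_iff_continuousAt.2 fun z => ?_
  by_cases hz : z ∈ O
  · exact hG.continuousAt (hO.mem_nhds hz)
  · have hzK : z ∉ K := fun h => hz (hKO h)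
    have hev : G =ᶠ[𝓝 z] fun _ => 0 := by
      filter_upwards [hK.isOpen_compl.mem_nhds hzK] with w hw using h0 w hw
    exact (continuousAt_const.congr hev.symm)

variable {S : Set ℝ}

omit [MeasurableSpace E] [BorelSpace E] [InnerProductSpace ℝ E] [FiniteDimensional ℝ E] in
/-- `∂ₜw` of a jointly `C¹` field on an open slab is jointly continuous on `S × E`: it is
`D(uncurry w)(t, x)(1, 0)` (the two-sided counterpart of
`continuousOn_timeDerivWithin_of_contDiffOn`, `SpaceTimeCalculusC1`). [folklore] -/
theorem continuousOn_timeDeriv_of_contDiffOn [NormedSpace ℝ E] {w : ℝ → E → F} (hS : IsOpen S)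
    (hw : ContDiffOn ℝ 1 (uncurry w) (S ×ˢ univ)) :
    ContinuousOn (fun z : ℝ × E => timeDeriv w z.1 z.2) (S ×ˢ univ) := by
  have hD : ContinuousOn (fderiv ℝ (uncurry w)) (S ×ˢ univ) :=
    hw.continuousOn_fderiv_of_isOpen (hS.prod isOpen_univ) le_rfl
  have h1 : ContinuousOn (fun z : ℝ × E => fderiv ℝ (uncurry w) z ((1 : ℝ), (0 : E))) (S ×ˢ univ) :=
    hD.clm_apply continuousOn_const
  refine h1.congr fun z hz => ?_
  exact (hasDerivAt_timeLine_of_contDiffOn hw (hS.mem_nhds hz.1) z.2).deriv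

/-- **Pairing in time.** Let `S` be open, `K ⊆ S × E` compact, `a, a' : ℝ → E → ℝ` with
`a = a' = 0` off `K`, `a'` jointly continuous on `S × E`, and `∂ₛ a(s, x) = a'(s, x)` for `s ∈ S`.
Then `∫∫ a' dx ds = 0`: on each time line `s ↦ a(s, x)` is `C¹` with compact support, so
`∫ a'(·, x) ds = 0`, and Fubini. (The step "`∫∫ |u|² ∂ₜφ = -∫∫ ∂ₜ|u|² φ`" of the derivation of
the weak formulations for smooth solutions; Caffarelli–Kohn–Nirenberg 1982, §2.) [cite: CaffarelliKohnNirenberg1982, §2] -/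
theorem integral_integral_eq_zero_of_hasDerivAt_time (hS : IsOpen S) {K : Set (ℝ × E)}
    (hK : IsCompact K) (hKS : K ⊆ S ×ˢ univ) {a a' : ℝ → E → ℝ}
    (hderiv : ∀ s ∈ S, ∀ x, HasDerivAt (fun σ => a σ x) (a' s x) s)
    (ha0 : ∀ z ∉ K, a z.1 z.2 = 0) (ha0' : ∀ z ∉ K, a' z.1 z.2 = 0)
    (hcont : ContinuousOn (uncurry a') (S ×ˢ univ)) :
    ∫ s, ∫ x, a' s x = 0 := by
  -- time lines are differentiable everywhere
  have htsupp : tsupport (uncurry a) ⊆ K := closure_minimal (fun z hz => by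
    by_contra h; exact hz (ha0 z h)) hK.isClosed
  have hderiv' : ∀ s x, HasDerivAt (fun σ => a σ x) (a' s x) s := by
    intro s x
    by_cases hs : s ∈ S
    · exact hderiv s hs x
    · have hz : (s, x) ∉ K := fun h => hs (hKS h).1
      rw [ha0' (s, x) hz]
      exact hasDerivAt_zero_of_notMem_tsupport fun h => hz (htsupp h)
  -- `a'` is continuous with compact support, hence integrable on `ℝ × E`
  have hc' : Continuous (uncurry a') :=
    continuous_of_continuousOn_of_eq_zero (hS.prod isOpen_univ) hK.isClosed hKS hcont
      fun z hz => ha0' z hz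
  have hcs' : HasCompactSupport (uncurry a') := HasCompactSupport.intro hK fun z hz => ha0' z hz
  have hint' : Integrable (uncurry a') ((volume : Measure ℝ).prod (volume : Measure E)) :=
    hc'.integrable_of_hasCompactSupport hcs'
  rw [integral_integral_swap hint']
  refine integral_eq_zero_of_ae (Eventually.of_forall fun x => ?_)
  -- on the time line through `x`
  have hKx : IsCompact (Prod.fst '' K) := hK.image continuous_fst
  have hline0 : ∀ s, s ∉ Prod.fst '' K → a s x = 0 := fun s hs =>
    ha0 (s, x) fun h => hs ⟨(s, x), h, rfl⟩
  have hline0' : ∀ s, s ∉ Prod.fst '' K → a' s x = 0 := fun s hs =>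
    ha0' (s, x) fun h => hs ⟨(s, x), h, rfl⟩
  have hca : Continuous fun s => a s x := continuous_iff_continuousAt.2 fun s =>
    (hderiv' s x).continuousAt
  have hca' : Continuous fun s => a' s x := hc'.comp (Continuous.prodMk_left x)
  exact integral_eq_zero_of_hasDerivAt_of_integrable (fun s => hderiv' s x)
    (hca'.integrable_of_hasCompactSupport (HasCompactSupport.intro hKx hline0'))
    (hca.integrable_of_hasCompactSupport (HasCompactSupport.intro hKx hline0))

/-- **From the region to iterated integrals.** A function on `ℝ × E` continuous on the open set
`S × E` and vanishing off a compact `K ⊆ Q ⊆ S × E` integrates over `Q` as the iterated integral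
`∫ (∫ · dx) dt` (Fubini for a continuous compactly supported integrand). [folklore] -/
theorem setIntegral_eq_integral_integral_of_continuousOn (hS : IsOpen S) {Q : Set (ℝ × E)}
    {K : Set (ℝ × E)} (hK : IsCompact K) (hKQ : K ⊆ Q) (hQS : Q ⊆ S ×ˢ univ) {G : ℝ × E → F}
    (hG : ContinuousOn G (S ×ˢ univ)) (h0 : ∀ z ∉ K, G z = 0) :
    ∫ z in Q, G z = ∫ t, ∫ x, G (t, x) := by
  have hc : Continuous G :=
    continuous_of_continuousOn_of_eq_zero (hS.prod isOpen_univ) hK.isClosed (hKQ.trans hQS) hG h0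
  have hint : Integrable G ((volume : Measure ℝ).prod (volume : Measure E)) :=
    hc.integrable_of_hasCompactSupport (HasCompactSupport.intro hK h0)
  rw [setIntegral_eq_integral_of_forall_compl_eq_zero fun z hz => h0 z fun h => hz (hKQ h),
    Measure.volume_eq_prod, integral_prod _ hint]

end SpaceTime

/-! ### `C²` classical solutions on `S × E` are suitable weak solutions on `Q ⊆ S × E` -/

section Suitable

variable {F : Type*} [NormedAddCommGroup F] [NormedSpace ℝ F]
variable {S : Set ℝ} {Q : Opens (ℝ × E)} {ν : ℝ} {f u : ℝ → E → E} {p : ℝ → E → ℝ}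

omit [InnerProductSpace ℝ E] [FiniteDimensional ℝ E] [MeasurableSpace E] [BorelSpace E]
  [NormedSpace ℝ F] in
/-- Off the support of the uncurried field, the slice support is avoided too. [folklore] -/
theorem notMem_tsupport_slice_of_notMem {ψ : ℝ → E → F} {t : ℝ} {x : E}
    (h : (t, x) ∉ tsupport (uncurry ψ)) : x ∉ tsupport (ψ t) := by
  intro hx
  apply h
  have hsub : tsupport (ψ t) ⊆ (fun y => (t, y)) ⁻¹' tsupport (uncurry ψ) :=
    closure_minimal (fun y hy => subset_tsupport _ (by simpa using hy))
      ((isClosed_tsupport _).preimage (Continuous.prodMk_right t))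
  exact hsub hx

omit [MeasurableSpace E] [BorelSpace E] [FiniteDimensional ℝ E] in
/-- Slices of a test function at times `t` with `{t} × E` disjoint from `Q` vanish identically. [folklore] -/
theorem IsSpaceTimeTestOn.slice_eq_zero_of_subset_prod {ψ : ℝ → E → F} (hψ : IsSpaceTimeTestOn Q ψ)
    (hQ : (Q : Set (ℝ × E)) ⊆ S ×ˢ univ) {t : ℝ} (ht : t ∉ S) : ψ t = 0 :=
  funext fun _ => hψ.apply_eq_zero fun h => ht (hQ h).1

omit [MeasurableSpace E] [BorelSpace E] [FiniteDimensional ℝ E] in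
/-- Joint continuity of the slice derivatives of a space–time test field. [folklore] -/
theorem IsSpaceTimeTestOn.continuous_fderiv_slice {ψ : ℝ → E → F} (hψ : IsSpaceTimeTestOn Q ψ) :
    Continuous fun z : ℝ × E => fderiv ℝ (ψ z.1) z.2 := by
  have := ((hψ.isSmoothSpaceTimeOn univ).fderiv_slice uniqueDiffOn_univ).continuousOn
  rw [univ_prod_univ, continuousOn_univ] at this
  exact this

omit [MeasurableSpace E] [BorelSpace E] in
/-- Joint continuity of the slice Laplacian of a space–time test field. [folklore] -/
theorem IsSpaceTimeTestOn.continuous_laplacian_slice {F' : Type*} [NormedAddCommGroup F']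
    [InnerProductSpace ℝ F'] {ψ : ℝ → E → F'} (hψ : IsSpaceTimeTestOn Q ψ) :
    Continuous fun z : ℝ × E => (Δ (ψ z.1)) z.2 := by
  have := ((hψ.isSmoothSpaceTimeOn univ).laplacian uniqueDiffOn_univ).continuousOn
  rw [univ_prod_univ, continuousOn_univ] at this
  exact this

omit [MeasurableSpace E] [BorelSpace E] in
/-- Joint continuity of the slice gradient of a scalar space–time test function. [folklore] -/
theorem IsSpaceTimeTestOn.continuous_slice_gradient {φ : ℝ → E → ℝ} (hφ : IsSpaceTimeTestOn Q φ) :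
    Continuous fun z : ℝ × E => gradient (φ z.1) z.2 := by
  have := ((hφ.isSmoothSpaceTimeOn univ).gradient uniqueDiffOn_univ).continuousOn
  rw [univ_prod_univ, continuousOn_univ] at this
  exact this

omit [MeasurableSpace E] [BorelSpace E] in
/-- Joint continuity of the slice divergence of a space–time test field. [folklore] -/
theorem IsSpaceTimeTestOn.continuous_divergence_slice {ψ : ℝ → E → E} (hψ : IsSpaceTimeTestOn Q ψ) :
    Continuous fun z : ℝ × E => VectorCalculus.divergence (ψ z.1) z.2 := by
  have h : (fun z : ℝ × E => VectorCalculus.divergence (ψ z.1) z.2) = fun z => ∑ i,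
      ⟪stdOrthonormalBasis ℝ E i, fderiv ℝ (ψ z.1) z.2 (stdOrthonormalBasis ℝ E i)⟫ :=
    funext fun z => divergence_eq_sum_inner_fderiv (stdOrthonormalBasis ℝ E) _ _
  rw [h]
  exact continuous_finsetSum _ fun i _ =>
    continuous_const.inner (hψ.continuous_fderiv_slice.clm_apply continuous_const)

/-- **Weak spatial gradient of a `C¹` field.** If `u` is jointly `C¹` on the open slab `S × E`
and `Q ⊆ S × E`, then the classical slice derivative `Dₓu` is a weak spatial gradient of `u` on
`Q` (integration by parts in `x` on each time slice, `WholeSpaceIBP`; Caffarelli–Kohn–Nirenberg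
1982, (2.1): for smooth `u` the distributional `∇u` is the classical one). [cite: CaffarelliKohnNirenberg1982, §2 (2.1)] -/
theorem hasWeakSpatialGradientOn_of_contDiffOn (hS : IsOpen S) (hQ : (Q : Set (ℝ × E)) ⊆ S ×ˢ univ)
    (hu : ContDiffOn ℝ 1 (uncurry u) (S ×ˢ univ)) :
    HasWeakSpatialGradientOn Q u fun t x => fderiv ℝ (u t) x where
  locallyIntegrableOn :=
    (hu.continuousOn.mono hQ).locallyIntegrableOn Q.isOpen.measurableSet
  locallyIntegrableOn_grad :=
    ((continuousOn_fderiv_slice_of_contDiffOn hu hS.uniqueDiffOn).mono hQ).locallyIntegrableOn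
      Q.isOpen.measurableSet
  integral_fderiv_mul_inner_eq φ hφ v w := by
    rw [← integral_neg]
    refine integral_congr_ae (Eventually.of_forall fun t => ?_)
    by_cases ht : t ∈ S
    · -- integration by parts on the slice
      have hu1 : ContDiff ℝ 1 (u t) := contDiff_slice_of_contDiffOn hu ht
      have hφ1 : ContDiff ℝ 1 (φ t) := (hφ.contDiff_slice t).of_le (by exact_mod_cast le_top)
      have hφc : HasCompactSupport (φ t) := hφ.hasCompactSupport_slice t
      set h : E → ℝ := fun x => φ t x * ⟪u t x, w⟫ with hh
      have hh1 : ContDiff ℝ 1 h := hφ1.mul (hu1.inner ℝ contDiff_const)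
      have hhc : HasCompactSupport h := hφc.mul_right
      have h0 := integral_fderiv_apply_eq_zero hh1 hhc v
      have hD : ∀ x, fderiv ℝ h x v =
          fderiv ℝ (φ t) x v * ⟪u t x, w⟫ + φ t x * ⟪fderiv ℝ (u t) x v, w⟫ := by
        intro x
        have h1 := ((hu1.differentiable one_ne_zero x).hasFDerivAt).inner ℝ (hasFDerivAt_const w x)
        have h2 : HasFDerivAt h _ x := ((hφ1.differentiable one_ne_zero x).hasFDerivAt).mul h1
        rw [h2.fderiv]
        simp only [add_apply, smul_apply, smul_eq_mul,
          ContinuousLinearMap.comp_apply, fderivInnerCLM_apply, ContinuousLinearMap.prod_apply,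
          inner_zero_right, zero_add, zero_apply]
        ring
      have i1 : Integrable (fun x => fderiv ℝ (φ t) x v * ⟪u t x, w⟫) (volume : Measure E) :=
        (((hφ1.continuous_fderiv one_ne_zero).clm_apply continuous_const).mul
          (hu1.continuous.inner continuous_const)).integrable_of_hasCompactSupport
          ((hφc.fderiv_apply (𝕜 := ℝ) v).mul_right)
      have i2 : Integrable (fun x => φ t x * ⟪fderiv ℝ (u t) x v, w⟫) (volume : Measure E) :=
        (hφ1.continuous.mul (((hu1.continuous_fderiv one_ne_zero).clm_apply
          continuous_const).inner continuous_const)).integrable_of_hasCompactSupport hφc.mul_right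
      simp_rw [hD] at h0
      rw [integral_add i1 i2] at h0
      linarith
    · simp [hφ.slice_eq_zero_of_subset_prod hQ ht]

/-- **`C²` classical solutions are distributional solutions.** Let `S ⊆ ℝ` be open,
`Q ⊆ S × E` open, `u` jointly `C²` and `p` jointly `C¹` on `S × E`, `f` jointly continuous there,
with `∂ₜu + (u·∇)u = νΔu − ∇p + f` and `div u = 0` pointwise on `S × E`. Then `(u, p)` solves
Navier–Stokes in `𝒟'(Q)` (`IsDistributionalNSSolutionOn`): the classes are immediate from
continuity, `div u = 0` weakly slice by slice, and the momentum identity follows from the slice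
identity `integral_inner_dt_test_of_momentum` and `∫∫ ⟪u, ∂ₜψ⟫ = −∫∫ ⟪∂ₜu, ψ⟫`
(Caffarelli–Kohn–Nirenberg 1982, §2, (2.2); Leray 1934, §III, (17)). [cite: CaffarelliKohnNirenberg1982, §2 (2.2)] -/
theorem isDistributionalNSSolutionOn_of_contDiffOn (hS : IsOpen S)
    (hQ : (Q : Set (ℝ × E)) ⊆ S ×ˢ univ) (hu : ContDiffOn ℝ 2 (uncurry u) (S ×ˢ univ))
    (hp : ContDiffOn ℝ 1 (uncurry p) (S ×ˢ univ)) (hf : ContinuousOn (uncurry f) (S ×ˢ univ))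
    (hmom : ∀ t ∈ S, ∀ x, timeDeriv u t x + convect (u t) (u t) x =
      ν • (Δ (u t)) x - gradient (p t) x + f t x)
    (hdiv : ∀ t ∈ S, VectorCalculus.IsDivFree (u t)) :
    IsDistributionalNSSolutionOn Q ν f u p := by
  have hu1 : ContDiffOn ℝ 1 (uncurry u) (S ×ˢ univ) := hu.of_le one_le_two
  have cu : ContinuousOn (uncurry u) (S ×ˢ univ) := hu.continuousOn
  have cu' : ContinuousOn (fun z : ℝ × E => u z.1 z.2) (S ×ˢ univ) := cu
  have cp : ContinuousOn (fun z : ℝ × E => p z.1 z.2) (S ×ˢ univ) := hp.continuousOn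
  have cf : ContinuousOn (fun z : ℝ × E => f z.1 z.2) (S ×ˢ univ) := hf
  have cdt : ContinuousOn (fun z : ℝ × E => timeDeriv u z.1 z.2) (S ×ˢ univ) :=
    continuousOn_timeDeriv_of_contDiffOn hS hu1
  have hincl : ∀ {t : ℝ}, t ∈ S → ∀ x : E, (fun y : E => (t, y)) x ∈ S ×ˢ (univ : Set E) :=
    fun ht x => ⟨ht, mem_univ x⟩
  refine ⟨(cu.mono hQ).locallyIntegrableOn Q.isOpen.measurableSet,
    ((cu.norm.pow 2).mono hQ).locallyIntegrableOn Q.isOpen.measurableSet,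
    (hp.continuousOn.mono hQ).locallyIntegrableOn Q.isOpen.measurableSet, ?_, ?_⟩
  · -- `div u = 0` weakly
    intro θ hθ
    set K : Set (ℝ × E) := tsupport (uncurry θ) with hK_def
    have hK : IsCompact K := hθ.hasCompactSupport
    have hKQ : K ⊆ (Q : Set (ℝ × E)) := hθ.tsupport_subset
    have hG : ContinuousOn (fun z : ℝ × E => ⟪u z.1 z.2, gradient (θ z.1) z.2⟫) (S ×ˢ univ) :=
      cu'.inner hθ.continuous_slice_gradient.continuousOn
    have h0 : ∀ z ∉ K, ⟪u z.1 z.2, gradient (θ z.1) z.2⟫ = 0 := fun z hz => by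
      rw [gradient_eq_zero_of_notMem_tsupport (notMem_tsupport_slice_of_notMem hz), inner_zero_right]
    rw [setIntegral_eq_integral_integral_of_continuousOn hS hK hKQ hQ hG h0]
    refine integral_eq_zero_of_ae (Eventually.of_forall fun t => ?_)
    by_cases ht : t ∈ S
    · exact VectorCalculus.IsDivFree.isWeaklyDivFree_holds (hdiv t ht)
        (contDiff_slice_of_contDiffOn hu1 ht) (θ t)
        ⟨hθ.contDiff_slice t, hθ.hasCompactSupport_slice t, fun _ _ => trivial⟩
    · simp only
      refine integral_eq_zero_of_ae (Eventually.of_forall fun x => h0 (t, x) fun h => ?_)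
      exact ht (hQ (hKQ h)).1
  · -- the momentum equation
    intro ψ hψ
    set K : Set (ℝ × E) := tsupport (uncurry ψ) with hK_def
    have hK : IsCompact K := hψ.hasCompactSupport
    have hKQ : K ⊆ (Q : Set (ℝ × E)) := hψ.tsupport_subset
    have hKS : K ⊆ S ×ˢ univ := hKQ.trans hQ
    -- vanishing off `K`
    have hψ0 : ∀ z ∉ K, ψ z.1 z.2 = 0 := fun z hz =>
      (image_eq_zero_of_notMem_tsupport hz : uncurry ψ z = 0)
    have hDψ0 : ∀ z ∉ K, fderiv ℝ (ψ z.1) z.2 = 0 := fun z hz =>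
      fderiv_of_notMem_tsupport ℝ (notMem_tsupport_slice_of_notMem hz)
    have hΔψ0 : ∀ z ∉ K, (Δ (ψ z.1)) z.2 = 0 := fun z hz =>
      laplacian_eq_zero_of_notMem_tsupport (notMem_tsupport_slice_of_notMem hz)
    have hdivψ0 : ∀ z ∉ K, VectorCalculus.divergence (ψ z.1) z.2 = 0 := fun z hz =>
      divergence_eq_zero_of_notMem_tsupport (notMem_tsupport_slice_of_notMem hz)
    have hTψ0 : ∀ z ∉ K, timeDeriv ψ z.1 z.2 = 0 := fun z hz =>
      timeDeriv_eq_zero_off_tsupport hz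
    -- the integrand and its continuity on `S × E`
    set G : ℝ × E → ℝ := fun z => ⟪u z.1 z.2, timeDeriv ψ z.1 z.2⟫ +
      ⟪u z.1 z.2, convect (u z.1) (ψ z.1) z.2⟫ + ν * ⟪u z.1 z.2, (Δ (ψ z.1)) z.2⟫ +
      p z.1 z.2 * VectorCalculus.divergence (ψ z.1) z.2 + ⟪f z.1 z.2, ψ z.1 z.2⟫ with hG_def
    have cψ : Continuous fun z : ℝ × E => ψ z.1 z.2 := hψ.contDiff.continuous
    have cTψ : Continuous fun z : ℝ × E => timeDeriv ψ z.1 z.2 := hψ.continuous_timeDeriv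
    have hGc : ContinuousOn G (S ×ˢ univ) := by
      refine ((((cu'.inner cTψ.continuousOn).add (cu'.inner
        (hψ.continuous_fderiv_slice.continuousOn.clm_apply cu'))).add
        (continuousOn_const.mul (cu'.inner hψ.continuous_laplacian_slice.continuousOn))).add
        (cp.mul hψ.continuous_divergence_slice.continuousOn)).add (cf.inner cψ.continuousOn)
    have hG0 : ∀ z ∉ K, G z = 0 := fun z hz => by
      simp only [hG_def, convect, hψ0 z hz, hDψ0 z hz, hΔψ0 z hz, hdivψ0 z hz, hTψ0 z hz]
      simp
    change ∫ z in (Q : Set (ℝ × E)), G z = 0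
    rw [setIntegral_eq_integral_integral_of_continuousOn hS hK hKQ hQ hGc hG0]
    -- the pairing `a = ⟪u, ψ⟫`, `a' = ⟪u, ∂ₜψ⟫ + ⟪∂ₜu, ψ⟫`
    set a : ℝ → E → ℝ := fun s x => ⟪u s x, ψ s x⟫ with ha_def
    set a' : ℝ → E → ℝ := fun s x => ⟪u s x, timeDeriv ψ s x⟫ + ⟪timeDeriv u s x, ψ s x⟫
      with ha'_def
    have hderiv : ∀ s ∈ S, ∀ x, HasDerivAt (fun σ => a σ x) (a' s x) s := by
      intro s hs x
      have hd := hasDerivAt_timeLine_of_contDiffOn hu1 (hS.mem_nhds hs) x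
      have h1 := hd.inner ℝ (hψ.hasDerivAt_time s x)
      refine h1.congr_deriv ?_
      simp only [ha'_def]
      rw [show timeDeriv u s x = fderiv ℝ (uncurry u) (s, x) (1, 0) from hd.deriv]
    have ha0 : ∀ z ∉ K, a z.1 z.2 = 0 := fun z hz => by simp [ha_def, hψ0 z hz]
    have ha0' : ∀ z ∉ K, a' z.1 z.2 = 0 := fun z hz => by
      simp only [ha'_def, hψ0 z hz, hTψ0 z hz, inner_zero_right, add_zero]
    have hcont : ContinuousOn (uncurry a') (S ×ˢ univ) :=
      (cu'.inner cTψ.continuousOn).add (cdt.inner cψ.continuousOn)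
    have key : ∀ t, ∫ x, G (t, x) = ∫ x, a' t x := by
      intro t
      by_cases ht : t ∈ S
      · -- slice regularity
        have hu2t : ContDiff ℝ 2 (u t) := contDiff_slice_of_contDiffOn hu ht
        have hp1t : ContDiff ℝ 1 (p t) := contDiff_slice_of_contDiffOn hp ht
        have hdtt : Continuous (timeDeriv u t) := cdt.comp_continuous (Continuous.prodMk_right t)
          (hincl ht)
        have hft : Continuous (f t) := cf.comp_continuous (Continuous.prodMk_right t) (hincl ht)
        have hut : Continuous (u t) := hu2t.continuous
        have hψ2 : ContDiff ℝ 2 (ψ t) := contDiff_infty.1 (hψ.contDiff_slice t) 2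
        have hψct : HasCompactSupport (ψ t) := hψ.hasCompactSupport_slice t
        have hslice := integral_inner_dt_test_of_momentum hu2t hp1t hdtt hft (hmom t ht)
          (hdiv t ht) hψ2 hψct
        -- compact `x`-support of the slice integrands
        have hKx : IsCompact (Prod.snd '' K) := hK.image continuous_snd
        have hx0 : ∀ x, x ∉ Prod.snd '' K → (t, x) ∉ K := fun x hx h => hx ⟨(t, x), h, rfl⟩
        have iT : Integrable (fun x => ⟪u t x, timeDeriv ψ t x⟫) (volume : Measure E) :=
          (hut.inner (cTψ.comp (Continuous.prodMk_right t))).integrable_of_hasCompactSupport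
            (HasCompactSupport.intro hKx fun x hx => by
              rw [hTψ0 (t, x) (hx0 x hx), inner_zero_right])
        have iT' : Integrable (fun x => ⟪timeDeriv u t x, ψ t x⟫) (volume : Measure E) :=
          integrable_inner_of_hasCompactSupport_right hdtt hψ2.continuous hψct
        have iR : Integrable (fun x => ⟪u t x, convect (u t) (ψ t) x⟫ +
            ν * ⟪u t x, (Δ (ψ t)) x⟫ + p t x * VectorCalculus.divergence (ψ t) x +
            ⟪f t x, ψ t x⟫) (volume : Measure E) := by
          refine Continuous.integrable_of_hasCompactSupport ?_
            (HasCompactSupport.intro hKx fun x hx => ?_)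
          · exact (((hut.inner (((hψ2.continuous_fderiv two_ne_zero)).clm_apply hut)).add
              (continuous_const.mul (hut.inner (continuous_laplacian hψ2)))).add
              (hp1t.continuous.mul (continuous_divergence
                ((hψ2.of_le one_le_two).continuous_fderiv one_ne_zero)))).add
              (hft.inner hψ2.continuous)
          · have hz := hx0 x hx
            simp only [convect, hDψ0 (t, x) hz, hΔψ0 (t, x) hz, hdivψ0 (t, x) hz, hψ0 (t, x) hz]
            simp
        have e1 : ∫ x, G (t, x) = (∫ x, ⟪u t x, timeDeriv ψ t x⟫) +
            ∫ x, (⟪u t x, convect (u t) (ψ t) x⟫ + ν * ⟪u t x, (Δ (ψ t)) x⟫ +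
              p t x * VectorCalculus.divergence (ψ t) x + ⟪f t x, ψ t x⟫) := by
          rw [← integral_add iT iR]
          refine integral_congr_ae (Eventually.of_forall fun x => ?_)
          simp only [hG_def]
          ring
        have e2 : ∫ x, a' t x = (∫ x, ⟪u t x, timeDeriv ψ t x⟫) + ∫ x, ⟪timeDeriv u t x, ψ t x⟫ := by
          rw [← integral_add iT iT']
        rw [e1, e2, hslice]
      · refine integral_congr_ae (Eventually.of_forall fun x => ?_)
        have hz : (t, x) ∉ K := fun h => ht (hKS h).1
        simp only
        rw [hG0 (t, x) hz, ha0' (t, x) hz]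
    rw [integral_congr_ae (Eventually.of_forall key)]
    exact integral_integral_eq_zero_of_hasDerivAt_time hS hK hKS hderiv ha0 ha0' hcont

/-- **The local energy equality for `C²` classical solutions.** In the setting of
`isDistributionalNSSolutionOn_of_contDiffOn`, for every scalar test function `φ` on `Q`,
`2ν ∫∫ |∇u|² φ = ∫∫ (|u|² (∂ₜφ + νΔφ) + (|u|² + 2p) u·∇φ + 2 ⟪f, u⟫ φ)` — the local energy
inequality (2.5) of Caffarelli–Kohn–Nirenberg *with equality* ("if `u` is smooth, (2.5) holds
with equality", CKN 1982, §2 after (2.5)): the slice balance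
`integral_energy_flux_eq_of_momentum`, the pairing in time `∫∫ ∂ₜφ |u|² = −∫∫ φ ∂ₜ|u|²`
(`integral_integral_eq_zero_of_hasDerivAt_time`) and Fubini. [cite: CaffarelliKohnNirenberg1982, §2 (2.5)] -/
theorem local_energy_eq_of_contDiffOn (hS : IsOpen S)
    (hQ : (Q : Set (ℝ × E)) ⊆ S ×ˢ univ) (hu : ContDiffOn ℝ 2 (uncurry u) (S ×ˢ univ))
    (hp : ContDiffOn ℝ 1 (uncurry p) (S ×ˢ univ)) (hf : ContinuousOn (uncurry f) (S ×ˢ univ))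
    (hmom : ∀ t ∈ S, ∀ x, timeDeriv u t x + convect (u t) (u t) x =
      ν • (Δ (u t)) x - gradient (p t) x + f t x)
    (hdiv : ∀ t ∈ S, VectorCalculus.IsDivFree (u t)) {φ : ℝ → E → ℝ} (hφ : IsSpaceTimeTestOn Q φ) :
    2 * ν * ∫ t, ∫ x, frobeniusNormSq (fderiv ℝ (u t) x) * φ t x =
      ∫ t, ∫ x, (‖u t x‖ ^ 2 * (timeDeriv φ t x + ν * (Δ (φ t)) x) +
        (‖u t x‖ ^ 2 + 2 * p t x) * ⟪u t x, gradient (φ t) x⟫ + 2 * ⟪f t x, u t x⟫ * φ t x) := by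
  have hu1 : ContDiffOn ℝ 1 (uncurry u) (S ×ˢ univ) := hu.of_le one_le_two
  have cu' : ContinuousOn (fun z : ℝ × E => u z.1 z.2) (S ×ˢ univ) := hu.continuousOn
  have cp : ContinuousOn (fun z : ℝ × E => p z.1 z.2) (S ×ˢ univ) := hp.continuousOn
  have cf : ContinuousOn (fun z : ℝ × E => f z.1 z.2) (S ×ˢ univ) := hf
  have cdt : ContinuousOn (fun z : ℝ × E => timeDeriv u z.1 z.2) (S ×ˢ univ) :=
    continuousOn_timeDeriv_of_contDiffOn hS hu1
  have cDu : ContinuousOn (fun z : ℝ × E => fderiv ℝ (u z.1) z.2) (S ×ˢ univ) :=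
    continuousOn_fderiv_slice_of_contDiffOn hu1 hS.uniqueDiffOn
  have hincl : ∀ {t : ℝ}, t ∈ S → ∀ x : E, (fun y : E => (t, y)) x ∈ S ×ˢ (univ : Set E) :=
    fun ht x => ⟨ht, mem_univ x⟩
  set K : Set (ℝ × E) := tsupport (uncurry φ) with hK_def
  have hK : IsCompact K := hφ.hasCompactSupport
  have hKQ : K ⊆ (Q : Set (ℝ × E)) := hφ.tsupport_subset
  have hKS : K ⊆ S ×ˢ univ := hKQ.trans hQ
  -- vanishing off `K`
  have hφ0 : ∀ z ∉ K, φ z.1 z.2 = 0 := fun z hz =>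
    (image_eq_zero_of_notMem_tsupport hz : uncurry φ z = 0)
  have hDφ0 : ∀ z ∉ K, fderiv ℝ (φ z.1) z.2 = 0 := fun z hz =>
    fderiv_of_notMem_tsupport ℝ (notMem_tsupport_slice_of_notMem hz)
  have hgφ0 : ∀ z ∉ K, gradient (φ z.1) z.2 = 0 := fun z hz =>
    gradient_eq_zero_of_notMem_tsupport (notMem_tsupport_slice_of_notMem hz)
  have hΔφ0 : ∀ z ∉ K, (Δ (φ z.1)) z.2 = 0 := fun z hz =>
    laplacian_eq_zero_of_notMem_tsupport (notMem_tsupport_slice_of_notMem hz)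
  have hTφ0 : ∀ z ∉ K, timeDeriv φ z.1 z.2 = 0 := fun z hz =>
    timeDeriv_eq_zero_off_tsupport hz
  -- joint continuity of the test-function derivatives
  have cφ : Continuous fun z : ℝ × E => φ z.1 z.2 := hφ.contDiff.continuous
  have cTφ : Continuous fun z : ℝ × E => timeDeriv φ z.1 z.2 := hφ.continuous_timeDeriv
  have cgφ : Continuous fun z : ℝ × E => gradient (φ z.1) z.2 := hφ.continuous_slice_gradient
  have cΔφ : Continuous fun z : ℝ × E => (Δ (φ z.1)) z.2 := hφ.continuous_laplacian_slice
  -- the right-hand integrand `R` and the dissipation integrand `D`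
  set R : ℝ × E → ℝ := fun z => ‖u z.1 z.2‖ ^ 2 * (timeDeriv φ z.1 z.2 + ν * (Δ (φ z.1)) z.2) +
    (‖u z.1 z.2‖ ^ 2 + 2 * p z.1 z.2) * ⟪u z.1 z.2, gradient (φ z.1) z.2⟫ +
    2 * ⟪f z.1 z.2, u z.1 z.2⟫ * φ z.1 z.2 with hR_def
  set D : ℝ × E → ℝ := fun z => frobeniusNormSq (fderiv ℝ (u z.1) z.2) * φ z.1 z.2 with hD_def
  have hR0 : ∀ z ∉ K, R z = 0 := fun z hz => by
    simp only [hR_def, hφ0 z hz, hgφ0 z hz, hΔφ0 z hz, hTφ0 z hz]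
    simp
  have hD0 : ∀ z ∉ K, D z = 0 := fun z hz => by simp only [hD_def, hφ0 z hz, mul_zero]
  have cD : ContinuousOn D (S ×ˢ univ) :=
    (LerayHopfProofs.continuous_frobeniusNormSq.comp_continuousOn cDu).mul cφ.continuousOn
  have cD' : Continuous D :=
    continuous_of_continuousOn_of_eq_zero (hS.prod isOpen_univ) hK.isClosed hKS cD hD0
  have iD : Integrable D ((volume : Measure ℝ).prod (volume : Measure E)) :=
    cD'.integrable_of_hasCompactSupport (HasCompactSupport.intro hK hD0)
  -- the pairing `a = φ |u|²`, `a' = ∂ₜφ |u|² + φ ∂ₜ|u|²`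
  set a : ℝ → E → ℝ := fun s x => φ s x * ‖u s x‖ ^ 2 with ha_def
  set a' : ℝ → E → ℝ := fun s x => timeDeriv φ s x * ‖u s x‖ ^ 2 +
    φ s x * (2 * ⟪u s x, timeDeriv u s x⟫) with ha'_def
  have hderiv : ∀ s ∈ S, ∀ x, HasDerivAt (fun σ => a σ x) (a' s x) s := by
    intro s hs x
    have hd := hasDerivAt_timeLine_of_contDiffOn hu1 (hS.mem_nhds hs) x
    have h1 := (hφ.hasDerivAt_time s x).mul hd.norm_sq
    refine h1.congr_deriv ?_
    simp only [ha'_def]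
    rw [show timeDeriv u s x = fderiv ℝ (uncurry u) (s, x) (1, 0) from hd.deriv]
  have ha0 : ∀ z ∉ K, a z.1 z.2 = 0 := fun z hz => by simp only [ha_def, hφ0 z hz, zero_mul]
  have ha0' : ∀ z ∉ K, a' z.1 z.2 = 0 := fun z hz => by
    simp only [ha'_def, hφ0 z hz, hTφ0 z hz, zero_mul, add_zero]
  have hcont : ContinuousOn (uncurry a') (S ×ˢ univ) :=
    (cTφ.continuousOn.mul (cu'.norm.pow 2)).add
      (cφ.continuousOn.mul (continuousOn_const.mul (cu'.inner cdt)))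
  have ca' : Continuous (uncurry a') :=
    continuous_of_continuousOn_of_eq_zero (hS.prod isOpen_univ) hK.isClosed hKS hcont
      fun z hz => ha0' z hz
  have ia' : Integrable (uncurry a') ((volume : Measure ℝ).prod (volume : Measure E)) :=
    ca'.integrable_of_hasCompactSupport (HasCompactSupport.intro hK fun z hz => ha0' z hz)
  have hpair : ∫ s, ∫ x, a' s x = 0 :=
    integral_integral_eq_zero_of_hasDerivAt_time hS hK hKS hderiv ha0 ha0' hcont
  -- the slice identity: `∫ R(t, ·) = ∫ a'(t, ·) + 2ν ∫ D(t, ·)`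
  have key : ∀ t, ∫ x, R (t, x) = (∫ x, a' t x) + 2 * ν * ∫ x, D (t, x) := by
    intro t
    by_cases ht : t ∈ S
    · have hu2t : ContDiff ℝ 2 (u t) := contDiff_slice_of_contDiffOn hu ht
      have hp1t : ContDiff ℝ 1 (p t) := contDiff_slice_of_contDiffOn hp ht
      have hdtt : Continuous (timeDeriv u t) := cdt.comp_continuous (Continuous.prodMk_right t)
        (hincl ht)
      have hft : Continuous (f t) := cf.comp_continuous (Continuous.prodMk_right t) (hincl ht)
      have hut : Continuous (u t) := hu2t.continuous
      have hφ2 : ContDiff ℝ 2 (φ t) := contDiff_infty.1 (hφ.contDiff_slice t) 2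
      have hφct : HasCompactSupport (φ t) := hφ.hasCompactSupport_slice t
      have hslice := integral_energy_flux_eq_of_momentum hu2t hp1t hdtt hft (hmom t ht)
        (hdiv t ht) hφ2 hφct
      have hKx : IsCompact (Prod.snd '' K) := hK.image continuous_snd
      have hx0 : ∀ x, x ∉ Prod.snd '' K → (t, x) ∉ K := fun x hx h => hx ⟨(t, x), h, rfl⟩
      -- the two pieces `A = ∂ₜφ |u|²` and `C` (the flux terms) of `R(t, ·)`
      have iA : Integrable (fun x => timeDeriv φ t x * ‖u t x‖ ^ 2) (volume : Measure E) :=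
        ((cTφ.comp (Continuous.prodMk_right t)).mul (hut.norm.pow 2)).integrable_of_hasCompactSupport
          (HasCompactSupport.intro hKx fun x hx => by
            show timeDeriv φ t x * ‖u t x‖ ^ 2 = 0
            rw [hTφ0 (t, x) (hx0 x hx), zero_mul])
      have iB : Integrable (fun x => φ t x * (2 * ⟪u t x, timeDeriv u t x⟫)) (volume : Measure E) :=
        (hφ2.continuous.mul (continuous_const.mul (hut.inner hdtt))).integrable_of_hasCompactSupport
          hφct.mul_right
      have iC : Integrable (fun x => ν * ((Δ (φ t)) x * ‖u t x‖ ^ 2) +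
          fderiv ℝ (φ t) x (u t x) * ‖u t x‖ ^ 2 + 2 * (p t x * fderiv ℝ (φ t) x (u t x)) +
          2 * (φ t x * ⟪f t x, u t x⟫)) (volume : Measure E) := by
        refine Continuous.integrable_of_hasCompactSupport ?_
          (HasCompactSupport.intro hKx fun x hx => ?_)
        · have hDφt : Continuous (fderiv ℝ (φ t)) :=
            (hφ2.of_le one_le_two).continuous_fderiv one_ne_zero
          exact (((continuous_const.mul ((continuous_laplacian hφ2).mul (hut.norm.pow 2))).add
            ((hDφt.clm_apply hut).mul (hut.norm.pow 2))).add
            (continuous_const.mul (hp1t.continuous.mul (hDφt.clm_apply hut)))).add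
            (continuous_const.mul (hφ2.continuous.mul (hft.inner hut)))
        · have hz := hx0 x hx
          simp only [hDφ0 (t, x) hz, hΔφ0 (t, x) hz, hφ0 (t, x) hz]
          simp
      have e1 : ∫ x, R (t, x) = (∫ x, timeDeriv φ t x * ‖u t x‖ ^ 2) +
          ∫ x, (ν * ((Δ (φ t)) x * ‖u t x‖ ^ 2) + fderiv ℝ (φ t) x (u t x) * ‖u t x‖ ^ 2 +
            2 * (p t x * fderiv ℝ (φ t) x (u t x)) + 2 * (φ t x * ⟪f t x, u t x⟫)) := by
        rw [← integral_add iA iC]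
        refine integral_congr_ae (Eventually.of_forall fun x => ?_)
        simp only [hR_def]
        rw [show ⟪u t x, gradient (φ t) x⟫ = fderiv ℝ (φ t) x (u t x) by
          rw [gradient, real_inner_comm, InnerProductSpace.toDual_symm_apply]]
        ring
      have e2 : ∫ x, a' t x = (∫ x, timeDeriv φ t x * ‖u t x‖ ^ 2) +
          ∫ x, φ t x * (2 * ⟪u t x, timeDeriv u t x⟫) := by
        rw [← integral_add iA iB]
      rw [e1, e2, hslice]
      ring
    · have h1 : ∫ x, R (t, x) = 0 :=
        integral_eq_zero_of_ae (Eventually.of_forall fun x => hR0 (t, x) fun h => ht (hKS h).1)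
      have h2 : ∫ x, a' t x = 0 :=
        integral_eq_zero_of_ae (Eventually.of_forall fun x => ha0' (t, x) fun h => ht (hKS h).1)
      have h3 : ∫ x, D (t, x) = 0 :=
        integral_eq_zero_of_ae (Eventually.of_forall fun x => hD0 (t, x) fun h => ht (hKS h).1)
      rw [h1, h2, h3]
      ring
  -- integrate in time
  have jA : Integrable (fun t => ∫ x, a' t x) (volume : Measure ℝ) := ia'.integral_prod_left
  have jD : Integrable (fun t => 2 * ν * ∫ x, D (t, x)) (volume : Measure ℝ) :=
    iD.integral_prod_left.const_mul _
  change 2 * ν * ∫ t, ∫ x, D (t, x) = ∫ t, ∫ x, R (t, x)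
  rw [integral_congr_ae (Eventually.of_forall key), integral_add jA jD, hpair, zero_add,
    integral_const_mul]

omit [InnerProductSpace ℝ E] [FiniteDimensional ℝ E] [MeasurableSpace E] [BorelSpace E] in
/-- A compact subset of `ℝ × E` has bounded `x`-shadow. [folklore] -/
theorem exists_snd_subset_closedBall_of_isCompact {K : Set (ℝ × E)} (hK : IsCompact K) :
    ∃ R : ℝ, ∀ z ∈ K, z.2 ∈ closedBall (0 : E) R := by
  obtain ⟨R, -, hR⟩ := (hK.image continuous_snd).isBounded.exists_pos_norm_le
  exact ⟨R, fun z hz => mem_closedBall_zero_iff.2 (hR z.2 ⟨z, hz, rfl⟩)⟩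

/-- **`C²` classical solutions are suitable weak solutions** (Caffarelli–Kohn–Nirenberg 1982,
§2: "if `u` is smooth, (2.5) holds with equality"; Scheffer; the remark of Tsai 1998, p. 33,
"(iv) is satisfied by any smooth solution of (1.1)"). Let `S ⊆ ℝ` be open and `Q ⊆ S × E` an
open space–time region; let `u` be jointly `C²` and `p` jointly `C¹` on `S × E`, `f` jointly
continuous there, with `∂ₜu + (u·∇)u = νΔu − ∇p + f` and `div u = 0` pointwise on `S × E`. Then
`(u, p)` is a suitable weak solution on `Q` in the sense of the accepted
`IsSuitableWeakSolutionOn` (Lin 1998, Def. 1): the equations hold in `𝒟'(Q)`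
(`isDistributionalNSSolutionOn_of_contDiffOn`), the local classes `u ∈ L^∞_t L²_x`,
`∇u ∈ L²`, `p ∈ L^{3/2}` on compact subsets of `Q` follow from continuity, the weak spatial
gradient is the classical one (`hasWeakSpatialGradientOn_of_contDiffOn`), and the local energy
inequality holds with equality (`local_energy_eq_of_contDiffOn`). No behaviour of `(u, p)` at the
boundary of `S × E` is assumed (e.g. blow-up at a final time is allowed). [cite: CaffarelliKohnNirenberg1982, §2 (2.1)–(2.5)] -/
theorem isSuitableWeakSolutionOn_of_contDiffOn (hS : IsOpen S)
    (hQ : (Q : Set (ℝ × E)) ⊆ S ×ˢ univ) (hu : ContDiffOn ℝ 2 (uncurry u) (S ×ˢ univ))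
    (hp : ContDiffOn ℝ 1 (uncurry p) (S ×ˢ univ)) (hf : ContinuousOn (uncurry f) (S ×ˢ univ))
    (hmom : ∀ t ∈ S, ∀ x, timeDeriv u t x + convect (u t) (u t) x =
      ν • (Δ (u t)) x - gradient (p t) x + f t x)
    (hdiv : ∀ t ∈ S, VectorCalculus.IsDivFree (u t)) :
    IsSuitableWeakSolutionOn Q ν f u p := by
  have hu1 : ContDiffOn ℝ 1 (uncurry u) (S ×ˢ univ) := hu.of_le one_le_two
  have cu : ContinuousOn (fun z : ℝ × E => u z.1 z.2) (S ×ˢ univ) := hu.continuousOn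
  have cp : ContinuousOn (fun z : ℝ × E => p z.1 z.2) (S ×ˢ univ) := hp.continuousOn
  have cDu : ContinuousOn (fun z : ℝ × E => fderiv ℝ (u z.1) z.2) (S ×ˢ univ) :=
    continuousOn_fderiv_slice_of_contDiffOn hu1 hS.uniqueDiffOn
  refine ⟨isDistributionalNSSolutionOn_of_contDiffOn hS hQ hu hp hf hmom hdiv, ?_, ?_, ?_⟩
  · -- `u ∈ L^∞_t L²_x` on compact subsets
    intro K hKQ hK
    obtain ⟨M, hM⟩ := hK.exists_bound_of_continuousOn (cu.mono (hKQ.trans hQ))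
    obtain ⟨R, hR⟩ := exists_snd_subset_closedBall_of_isCompact hK
    have hfin : ENNReal.ofReal M ^ 2 * volume (closedBall (0 : E) R) ≠ (⊤ : ℝ≥0∞) :=
      ENNReal.mul_ne_top (ENNReal.pow_ne_top ENNReal.ofReal_ne_top) measure_closedBall_lt_top.ne
    refine ⟨(ENNReal.ofReal M ^ 2 * volume (closedBall (0 : E) R)).toNNReal,
      Eventually.of_forall fun t => ?_⟩
    rw [ENNReal.coe_toNNReal hfin]
    calc ∫⁻ x, K.indicator (fun z : ℝ × E => ‖u z.1 z.2‖ₑ ^ 2) (t, x)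
        ≤ ∫⁻ x, (closedBall (0 : E) R).indicator (fun _ => ENNReal.ofReal M ^ 2) x := by
          refine lintegral_mono fun x => ?_
          by_cases hz : (t, x) ∈ K
          · rw [indicator_of_mem hz, indicator_of_mem (hR _ hz)]
            have h1 : ‖u t x‖ₑ ≤ ENNReal.ofReal M := by
              rw [← ofReal_norm]
              exact ENNReal.ofReal_le_ofReal (hM _ hz)
            exact pow_le_pow_left' h1 2
          · rw [indicator_of_notMem hz]
            exact zero_le
      _ = ENNReal.ofReal M ^ 2 * volume (closedBall (0 : E) R) :=
          lintegral_indicator_const measurableSet_closedBall _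
  · -- `p ∈ L^{3/2}` on compact subsets
    intro K hKQ hK
    obtain ⟨M, hM⟩ := hK.exists_bound_of_continuousOn (cp.mono (hKQ.trans hQ))
    have hle : ∀ z ∈ K, ‖p z.1 z.2‖ₑ ^ (3 / 2 : ℝ) ≤ ENNReal.ofReal M ^ (3 / 2 : ℝ) := by
      intro z hz
      refine ENNReal.rpow_le_rpow ?_ (by norm_num)
      rw [← ofReal_norm]
      exact ENNReal.ofReal_le_ofReal (hM z hz)
    calc ∫⁻ z in K, ‖p z.1 z.2‖ₑ ^ (3 / 2 : ℝ)
        ≤ ∫⁻ _ in K, ENNReal.ofReal M ^ (3 / 2 : ℝ) :=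
          setLIntegral_mono measurable_const fun z hz => hle z hz
      _ = ENNReal.ofReal M ^ (3 / 2 : ℝ) * volume K := setLIntegral_const _ _
      _ < (⊤ : ℝ≥0∞) := ENNReal.mul_lt_top (ENNReal.rpow_lt_top_of_nonneg
          (by norm_num : (0 : ℝ) ≤ 3 / 2) ENNReal.ofReal_ne_top) hK.measure_lt_top
  · -- weak gradient, `∇u ∈ L²` on compact subsets, local energy (in)equality
    refine ⟨fun t x => fderiv ℝ (u t) x, hasWeakSpatialGradientOn_of_contDiffOn hS hQ hu1,
      fun K hKQ hK => ?_, fun φ hφ _ => (local_energy_eq_of_contDiffOn hS hQ hu hp hf hmom hdiv hφ).le⟩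
    obtain ⟨M, hM⟩ := hK.exists_bound_of_continuousOn
      ((LerayHopfProofs.continuous_frobeniusNormSq.comp_continuousOn cDu).mono (hKQ.trans hQ))
    have hle : ∀ z ∈ K, ENNReal.ofReal (frobeniusNormSq (fderiv ℝ (u z.1) z.2)) ≤
        ENNReal.ofReal M := by
      intro z hz
      refine ENNReal.ofReal_le_ofReal ?_
      have := hM z hz
      simp only [Function.comp_apply, Real.norm_of_nonneg (frobeniusNormSq_nonneg _)] at this
      exact this
    calc ∫⁻ z in K, ENNReal.ofReal (frobeniusNormSq (fderiv ℝ (u z.1) z.2))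
        ≤ ∫⁻ _ in K, ENNReal.ofReal M := setLIntegral_mono measurable_const fun z hz => hle z hz
      _ = ENNReal.ofReal M * volume K := setLIntegral_const _ _
      _ < (⊤ : ℝ≥0∞) := ENNReal.mul_lt_top ENNReal.ofReal_lt_top hK.measure_lt_top

end Suitable

end Literature.Analysis.FluidPDE

end
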